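import Mathlib
import Summits.CriticalPhenomena.SAWScalingLimit.Theorems.SAWDefectDecoherenceBoundaryClosureRPoleOrder
import Summits.CriticalPhenomena.SAWScalingLimit.Theorems.SAWDefectDecoherenceBoundaryClosureRPoleParity
import Literature.Probability.RandomPlanarGeometry.SLEHullBoundaryArea
import HarnessLib

/-!
# Real-line rigidity, step 3: the corner singularities are removable
# (crux `BoundaryClosureR`, stmt-CriticalPhenomena-14004, line `polygon-parity-squeeze`,
# sub-goal (A2-main) `realLine_rigidity`, registered helper `realLine_cornerRemovable`)

Let `K̃` be the global reflection of step 2: holomorphic off the complexified finite set `X`,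
conjugation-symmetric off the axis, a non-negative real on `ℝ ∖ X`, with `ν = re K̃ dx` on open
corner-free subsets of the line.  At a corner `x ∈ X` suppose `‖w - x‖ ^ γ ‖K̃ w‖` is
area-integrable on an upper half-disc (`0 ≤ γ < 1`) and `∫ |t - x| ^ β dν < ∞` near `x`
(`0 ≤ β < 1`).  Then `x` is a removable singularity of `K̃` (`realLine_cornerRemovable`):

* the weighted bound reflects to the punctured disc (conjugation preserves Lebesgue measure, the
  axis is null — the tree's `volume_setOf_im_eq_zero`), so `M = (w - x)² K̃` extends
  holomorphically (`pole_order_of_weightedL1`, `n = 2`);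
* `M(x) = 0`: otherwise `re K̃(t) = |M(t)| / (t - x)² ≥ c (t - x)⁻²` to the right of `x`, and
  `ν = re K̃ dt` there makes `∫ |t - x| ^ β dν ≥ c ∫₀ s ^ (β - 2) ds = ∞` (`β - 2 < -1`);
* `M = (w - x) M₁` and `M₁(x) = 0`: otherwise `(w - x) K̃ → M₁(x) ≠ 0` with `K̃ ≥ 0` on both sides
  of `x`, and `even_order_of_nonneg_real_pole` would make `1` even;
* hence `K̃ = M₂ := M₁ / (w - x)` near `x`, holomorphic.
-/

noncomputable section

open scoped Topology ENNReal ComplexConjugate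
open Filter Set MeasureTheory Metric Complex

namespace Summit.CriticalPhenomena.SAWScalingLimit.Theorems.PolygonParitySqueeze

namespace RealLine

/-- **Reflecting integrability across the axis.**  If `s ⊆ ℂ` is measurable and
conjugation-symmetric and `Φ (conj z) = Φ z` on its upper part, then integrability of `Φ` on the
upper part `s ∩ {im > 0}` gives integrability on all of `s` (conjugation preserves Lebesgue
measure; the axis is null). [folklore] -/
theorem integrableOn_of_upper_half {Φ : ℂ → ℝ} {s : Set ℂ} (hsm : MeasurableSet s)
    (hs : ∀ z ∈ s, conj z ∈ s) (hΦ : ∀ z ∈ s, 0 < z.im → Φ (conj z) = Φ z)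
    (hint : IntegrableOn Φ (s ∩ {z : ℂ | 0 < z.im})) : IntegrableOn Φ s := by
  have hpos : MeasurableSet {z : ℂ | 0 < z.im} := (isOpen_lt continuous_const continuous_im).measurableSet
  -- the lower part, by reflection
  have hlow : IntegrableOn Φ (s ∩ {z : ℂ | z.im < 0}) := by
    have hmp : MeasurePreserving (conjLIE : ℂ → ℂ) volume volume := conjLIE.measurePreserving
    have hme : MeasurableEmbedding (conjLIE : ℂ → ℂ) := conjLIE.toHomeomorph.measurableEmbedding
    refine (hmp.integrableOn_comp_preimage hme).1 ?_
    have hpre : (conjLIE : ℂ → ℂ) ⁻¹' (s ∩ {z : ℂ | z.im < 0}) = s ∩ {z : ℂ | 0 < z.im} := by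
      ext z
      simp only [mem_preimage, mem_inter_iff, mem_setOf_eq, conjLIE_apply, conj_im, neg_lt_zero]
      constructor
      · rintro ⟨h1, h2⟩
        exact ⟨by simpa using hs _ h1, h2⟩
      · rintro ⟨h1, h2⟩
        exact ⟨hs _ h1, h2⟩
    rw [hpre]
    refine hint.congr_fun (fun z hz => ?_) (hsm.inter hpos)
    simp only [Function.comp_apply, conjLIE_apply]
    exact (hΦ z hz.1 hz.2).symm
  -- the axis is null
  have hline : IntegrableOn Φ {z : ℂ | z.im = 0} := by
    rw [IntegrableOn, Measure.restrict_eq_zero.2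
      Literature.Probability.RandomPlanarGeometry.volume_setOf_im_eq_zero]
    exact integrable_zero_measure
  refine ((hint.union hlow).union hline).mono_set fun z hz => ?_
  rcases lt_trichotomy z.im 0 with h | h | h
  · exact Or.inl (Or.inr ⟨hz, h⟩)
  · exact Or.inr h
  · exact Or.inl (Or.inl ⟨hz, h⟩)

/-- Around a point `x` of a finite real set `X`, a punctured disc avoiding (the complexification
of) `X`. [folklore] -/
theorem exists_ball_diff_subset (X : Finset ℝ) (x : ℝ) :
    ∃ r₁ > 0, ball (x : ℂ) r₁ \ {(x : ℂ)} ⊆ ((fun x : ℝ => (x : ℂ)) '' (X : Set ℝ))ᶜ := by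
  classical
  set Y : Set ℂ := (fun x : ℝ => (x : ℂ)) '' ((X.erase x : Finset ℝ) : Set ℝ) with hY
  have hfin : Y.Finite := (Finset.finite_toSet _).image _
  have hxmem : (x : ℂ) ∈ Yᶜ := by
    rintro ⟨x', hx', hx'x⟩
    rw [Finset.coe_erase] at hx'
    exact hx'.2 (ofReal_injective hx'x)
  obtain ⟨r₁, hr₁, hsub⟩ := Metric.isOpen_iff.1 hfin.isClosed.isOpen_compl _ hxmem
  refine ⟨r₁, hr₁, ?_⟩
  rintro w ⟨hw, hwx⟩ ⟨x', hx', rfl⟩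
  refine hsub hw ⟨x', ?_, rfl⟩
  rw [Finset.coe_erase]
  exact ⟨hx', fun h => hwx (by rw [show x' = x from h]; rfl)⟩

/-- Real points of a disc centred on the axis. [folklore] -/
theorem ofReal_mem_ball {t x r : ℝ} (ht : t ∈ Ioo (x - r) (x + r)) : (t : ℂ) ∈ ball (x : ℂ) r := by
  rw [mem_ball, dist_eq_norm, ← ofReal_sub, norm_real, Real.norm_eq_abs, abs_lt]
  constructor <;> linarith [ht.1, ht.2]

/-- **Divergence of the `β`-moment at a double pole.**  If `M` is continuous at `x` with
`M(x) ≠ 0`, `M(t) = (t - x)² K̃(t)` and `K̃(t) ≥ 0` real for `t ∈ (x, x + r)`, and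
`ν = re K̃ dt` on the intervals `(x, x + r')`, `r' ≤ r`, then `∫_{(x, x+r)} |t - x| ^ β dν = ∞`
for `β < 1` (the density is `≥ c (t - x)⁻²` near `x` and `s ^ (β - 2)` is not integrable at
`0`). [folklore] -/
theorem lintegral_moment_eq_top {Kt M : ℂ → ℂ} {ν : Measure ℝ} {x r β : ℝ} (hr : 0 < r)
    (hβ1 : β < 1) (hMc : ContinuousAt M x) (hMx : M x ≠ 0)
    (hMeq : ∀ t ∈ Ioo x (x + r), M t = ((t : ℂ) - x) ^ 2 * Kt t)
    (hpos : ∀ t ∈ Ioo x (x + r), (Kt t).im = 0 ∧ 0 ≤ (Kt t).re)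
    (hKc : ContinuousOn (fun t : ℝ => Kt t) (Ioo x (x + r)))
    (hdens : ∀ r' : ℝ, 0 < r' → r' ≤ r → ν.restrict (Ioo x (x + r')) =
      (volume.withDensity fun t : ℝ => ENNReal.ofReal (Kt t).re).restrict (Ioo x (x + r'))) :
    ∫⁻ t in Ioo x (x + r), ENNReal.ofReal (|t - x| ^ β) ∂ν = ⊤ := by
  -- a radius on which `‖M‖ ≥ ‖M x‖ / 2`
  have hε : 0 < ‖M x‖ / 2 := by positivity
  obtain ⟨δ, hδ, hδM⟩ := Metric.continuousAt_iff.1 hMc _ hε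
  set r₂ : ℝ := min δ r with hr₂
  have hr₂0 : 0 < r₂ := lt_min hδ hr
  have hr₂r : r₂ ≤ r := min_le_right _ _
  have hMlow : ∀ t ∈ Ioo x (x + r₂), ‖M x‖ / 2 ≤ ‖M t‖ := by
    intro t ht
    have hd : dist (t : ℂ) x < δ := by
      rw [dist_eq_norm, ← ofReal_sub, norm_real, Real.norm_eq_abs, abs_lt]
      constructor <;> linarith [ht.1, ht.2, min_le_left δ r]
    have h1 := hδM hd
    rw [dist_eq_norm] at h1
    have h2 : ‖M x‖ ≤ ‖M t - M x‖ + ‖M t‖ := by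
      calc ‖M x‖ = ‖M t - (M t - M x)‖ := by rw [sub_sub_cancel]
        _ ≤ ‖M t‖ + ‖M t - M x‖ := norm_sub_le _ _
        _ = ‖M t - M x‖ + ‖M t‖ := add_comm _ _
    linarith
  set C : ℝ := ‖M x‖ / 2 with hC
  -- pointwise lower bound for the density times the weight
  have hpt : ∀ t ∈ Ioo x (x + r₂), ENNReal.ofReal (C * (t - x) ^ (β - 2)) ≤
      ENNReal.ofReal (Kt t).re * ENNReal.ofReal (|t - x| ^ β) := by
    intro t ht
    have htr : t ∈ Ioo x (x + r) := ⟨ht.1, lt_of_lt_of_le ht.2 (by linarith)⟩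
    have htx : 0 < t - x := by linarith [ht.1]
    obtain ⟨him, hre⟩ := hpos t htr
    have hnorm : ‖Kt t‖ = (Kt t).re := by
      have h' : Kt t = ((Kt t).re : ℂ) := Complex.ext (by simp) (by simp [him])
      calc ‖Kt t‖ = ‖(((Kt t).re : ℝ) : ℂ)‖ := congrArg _ h'
        _ = (Kt t).re := by rw [norm_real, Real.norm_of_nonneg hre]
    have hKt : (Kt t).re = ‖M t‖ / (t - x) ^ 2 := by
      rw [← hnorm, hMeq t htr, norm_mul, norm_pow, ← ofReal_sub, norm_real, Real.norm_of_nonneg htx.le]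
      field_simp
    rw [← ENNReal.ofReal_mul hre, hKt, abs_of_pos htx]
    refine ENNReal.ofReal_le_ofReal ?_
    rw [Real.rpow_sub htx, Real.rpow_two, hC]
    rw [show ‖M t‖ / (t - x) ^ 2 * (t - x) ^ β = ‖M t‖ * ((t - x) ^ β / (t - x) ^ 2) by ring,
      show ‖M x‖ / 2 * ((t - x) ^ β / (t - x) ^ 2) = ‖M x‖ / 2 * ((t - x) ^ β / (t - x) ^ 2) by rfl]
    exact mul_le_mul_of_nonneg_right (hMlow t ht) (by positivity)
  -- the model integral diverges
  have hdiv : ∫⁻ t in Ioo x (x + r₂), ENNReal.ofReal ((t - x) ^ (β - 2)) = ⊤ := by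
    have htrans : ∫⁻ t in Ioo x (x + r₂), ENNReal.ofReal ((t - x) ^ (β - 2)) =
        ∫⁻ s in Ioo 0 r₂, ENNReal.ofReal (s ^ (β - 2)) := by
      have hpre : (fun t : ℝ => t - x) ⁻¹' Ioo 0 r₂ = Ioo x (x + r₂) := by
        ext t; simp only [mem_preimage, mem_Ioo]; constructor <;> intro h <;> constructor <;> linarith [h.1, h.2]
      have h1 := lintegral_sub_right_eq_self (μ := (volume : Measure ℝ))
        (fun s : ℝ => (Ioo 0 r₂).indicator (fun s => ENNReal.ofReal (s ^ (β - 2))) s) x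
      rw [lintegral_indicator measurableSet_Ioo] at h1
      have hms : MeasurableSet ((fun t : ℝ => t - x) ⁻¹' Ioo 0 r₂) := by
        rw [hpre]; exact measurableSet_Ioo
      rw [← h1, ← hpre, ← lintegral_indicator hms]
      exact lintegral_congr fun t => indicator_comp_right (fun t : ℝ => t - x)
        (s := Ioo 0 r₂) (g := fun s => ENNReal.ofReal (s ^ (β - 2))) (x := t)
    rw [htrans]
    by_contra hne
    have hmeas : AEStronglyMeasurable (fun s : ℝ => s ^ (β - 2)) (volume.restrict (Ioo 0 r₂)) :=
      (measurable_id.pow_const (β - 2)).aestronglyMeasurable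
    have hnn : 0 ≤ᵐ[volume.restrict (Ioo 0 r₂)] fun s : ℝ => s ^ (β - 2) :=
      (ae_restrict_iff' measurableSet_Ioo).2 (Eventually.of_forall fun s hs =>
        Real.rpow_nonneg hs.1.le _)
    have hint : IntegrableOn (fun s : ℝ => s ^ (β - 2)) (Ioo 0 r₂) :=
      (lintegral_ofReal_ne_top_iff_integrable hmeas hnn).1 hne
    have := (intervalIntegral.integrableOn_Ioo_rpow_iff hr₂0).1 hint
    linarith
  -- assemble
  have hdm : AEMeasurable (fun t : ℝ => ENNReal.ofReal (Kt t).re) (volume.restrict (Ioo x (x + r₂))) :=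
    (ENNReal.continuous_ofReal.comp_continuousOn (continuous_re.comp_continuousOn
      (hKc.mono (Ioo_subset_Ioo le_rfl (by linarith))))).aemeasurable measurableSet_Ioo
  refine eq_top_iff.2 ?_
  calc (⊤ : ℝ≥0∞) = ENNReal.ofReal C * ∫⁻ t in Ioo x (x + r₂), ENNReal.ofReal ((t - x) ^ (β - 2)) := by
        rw [hdiv, ENNReal.mul_top]
        exact (ENNReal.ofReal_pos.2 hε).ne'
    _ = ∫⁻ t in Ioo x (x + r₂), ENNReal.ofReal (C * (t - x) ^ (β - 2)) := by
        rw [← lintegral_const_mul' _ _ ENNReal.ofReal_ne_top]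
        refine lintegral_congr fun t => ?_
        rw [ENNReal.ofReal_mul hε.le]
    _ ≤ ∫⁻ t in Ioo x (x + r₂), ENNReal.ofReal (Kt t).re * ENNReal.ofReal (|t - x| ^ β) :=
        setLIntegral_mono' measurableSet_Ioo hpt
    _ = ∫⁻ t in Ioo x (x + r₂), ENNReal.ofReal (|t - x| ^ β)
          ∂(volume.withDensity fun t : ℝ => ENNReal.ofReal (Kt t).re) := by
        rw [setLIntegral_withDensity_eq_setLIntegral_mul_non_measurable₀ _ hdm _ measurableSet_Ioo
          (Eventually.of_forall fun _ => ENNReal.ofReal_lt_top)]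
        rfl
    _ = ∫⁻ t in Ioo x (x + r₂), ENNReal.ofReal (|t - x| ^ β) ∂ν := by
        show ∫⁻ t, _ ∂((volume.withDensity _).restrict _) = ∫⁻ t, _ ∂(ν.restrict _)
        rw [hdens r₂ hr₂0 hr₂r]
    _ ≤ ∫⁻ t in Ioo x (x + r), ENNReal.ofReal (|t - x| ^ β) ∂ν :=
        lintegral_mono_set (Ioo_subset_Ioo le_rfl (by linarith))


/-- **Registered helper `realLine_cornerRemovable`** (step (3) of `realLine_rigidity`, line
`polygon-parity-squeeze`): a corner `x ∈ X` of the global reflection `K̃` (holomorphic off `X`,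
conjugation-symmetric, `≥ 0` on `ℝ ∖ X`, `ν = re K̃ dx` on open corner-free sets) with a weighted
area bound `‖w - x‖ ^ γ ‖K̃‖ ∈ L¹` (`γ < 1`) on an upper half-disc and a finite boundary moment
`∫ |t - x| ^ β dν < ∞` (`β < 1`) is a removable singularity: pole order `≤ 2` by
`pole_order_of_weightedL1`, order `2` killed by the `β`-moment (`lintegral_moment_eq_top`),
order `1` killed by parity (`even_order_of_nonneg_real_pole`). [folklore] -/
theorem realLine_cornerRemovable : ∀ (Kt : ℂ → ℂ) (X : Finset ℝ) (ν : MeasureTheory.Measure ℝ) (x r₀ γ β : ℝ), x ∈ X → DifferentiableOn ℂ Kt ((fun x : ℝ => (x : ℂ)) '' (X : Set ℝ))ᶜ → (∀ w : ℂ, w.im ≠ 0 → Kt (starRingEnd ℂ w) = starRingEnd ℂ (Kt w)) → (∀ t : ℝ, t ∉ X → (Kt t).im = 0 ∧ 0 ≤ (Kt t).re) → (∀ S : Set ℝ, IsOpen S → (∀ x ∈ X, x ∉ S) → ν.restrict S = (MeasureTheory.volume.withDensity fun t : ℝ => ENNReal.ofReal (Kt t).re).restrict S) → 0 < r₀ →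 0 ≤ γ → γ < 1 → β < 1 → MeasureTheory.IntegrableOn (fun w : ℂ => (‖w - (x : ℂ)‖ ^ γ : ℝ) * ‖Kt w‖) (Metric.ball (x : ℂ) r₀ ∩ {w : ℂ | 0 < w.im}) → ∫⁻ t in Set.Ioo (x - r₀) (x + r₀), ENNReal.ofReal (|t - x| ^ β) ∂ν < ⊤ → ∃ ρ : ℝ, 0 < ρ ∧ ∃ M : ℂ → ℂ, DifferentiableOn ℂ M (Metric.ball (x : ℂ) ρ) ∧ Set.EqOn M Kt (Metric.ball (x : ℂ) ρ \ {(x : ℂ)}) := by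
  intro Kt X ν x r₀ γ β hx hKtd hKt_conj hKt_pos hKt_dens hr₀ hγ0 hγ1 hβ1 hint hmom
  -- a punctured disc around `x` avoiding the other corners
  obtain ⟨r₁, hr₁, hr₁U⟩ := exists_ball_diff_subset X x
  set r : ℝ := min r₀ r₁ with hrdef
  have hr : 0 < r := lt_min hr₀ hr₁
  have hrr₀ : r ≤ r₀ := min_le_left _ _
  have hsubU : ball (x : ℂ) r \ {(x : ℂ)} ⊆ ((fun x : ℝ => (x : ℂ)) '' (X : Set ℝ))ᶜ :=
    (sdiff_subset_sdiff_left (ball_subset_ball (min_le_right _ _))).trans hr₁U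
  have hreal : ∀ t : ℝ, t ∈ Ioo (x - r) (x + r) → t ≠ x → t ∉ X := by
    intro t ht htx hmem
    exact hsubU ⟨ofReal_mem_ball ht, fun h => htx (ofReal_injective h)⟩ ⟨t, hmem, rfl⟩
  have hKd : DifferentiableOn ℂ Kt (ball (x : ℂ) r \ {(x : ℂ)}) := hKtd.mono hsubU
  -- the weighted bound on the punctured disc
  have hKi : IntegrableOn (fun w : ℂ => (‖w - (x : ℂ)‖ ^ γ : ℝ) * ‖Kt w‖)
      (ball (x : ℂ) r \ {(x : ℂ)}) := by
    refine integrableOn_of_upper_half (measurableSet_ball.diff (measurableSet_singleton _))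
      (fun z hz => ⟨?_, fun h => hz.2 ?_⟩) (fun z _ hzim => ?_)
      (hint.mono_set (inter_subset_inter_left _ (sdiff_subset.trans (ball_subset_ball hrr₀))))
    · rw [mem_ball, ← conj_ofReal, dist_conj_conj]
      exact hz.1
    · have h' : conj z = (x : ℂ) := h
      rw [mem_singleton_iff, ← conj_conj z, h', conj_ofReal]
    · show ‖conj z - (x : ℂ)‖ ^ γ * ‖Kt (conj z)‖ = ‖z - (x : ℂ)‖ ^ γ * ‖Kt z‖
      rw [hKt_conj z hzim.ne', norm_conj, ← conj_ofReal, ← map_sub, norm_conj, conj_ofReal]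
  -- pole of order at most two: `M = (w - x)² K̃` extends
  obtain ⟨M, hMd, hMeq⟩ := pole_order_of_weightedL1 Kt x r γ 2 hr hγ0
    (by norm_num; linarith) hKd hKi
  have hball : ball (x : ℂ) r ∈ 𝓝 (x : ℂ) := ball_mem_nhds _ hr
  have hpunct : ball (x : ℂ) r \ {(x : ℂ)} ∈ 𝓝[≠] (x : ℂ) := sdiff_mem_nhdsWithin_compl hball _
  have hbdry : ∀ᶠ t : ℝ in 𝓝[≠] x, 0 ≤ (Kt t).re ∧ (Kt t).im = 0 := by
    have h1 : Ioo (x - r) (x + r) ∈ 𝓝[≠] x :=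
      mem_nhdsWithin_of_mem_nhds (Ioo_mem_nhds (by linarith) (by linarith))
    filter_upwards [h1, self_mem_nhdsWithin] with t ht htx
    exact ⟨(hKt_pos t (hreal t ht htx)).2, (hKt_pos t (hreal t ht htx)).1⟩
  -- `M x = 0`, by the `β`-moment
  have hMx : M x = 0 := by
    by_contra hMx0
    refine absurd (lintegral_moment_eq_top (Kt := Kt) (ν := ν) hr hβ1
      (hMd.continuousOn.continuousAt hball) hMx0 (fun t ht => ?_) (fun t ht => ?_) ?_ ?_) ?_
    · have ht' : t ∈ Ioo (x - r) (x + r) := ⟨by linarith [ht.1], ht.2⟩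
      exact hMeq ⟨ofReal_mem_ball ht', fun h => (ne_of_gt ht.1) (ofReal_injective h)⟩
    · have ht' : t ∈ Ioo (x - r) (x + r) := ⟨by linarith [ht.1], ht.2⟩
      exact hKt_pos t (hreal t ht' (ne_of_gt ht.1))
    · refine hKd.continuousOn.comp continuous_ofReal.continuousOn fun t ht => ?_
      have ht' : t ∈ Ioo (x - r) (x + r) := ⟨by linarith [ht.1], ht.2⟩
      exact ⟨ofReal_mem_ball ht', fun h => (ne_of_gt ht.1) (ofReal_injective h)⟩
    · intro r' hr' hr'r
      refine hKt_dens _ isOpen_Ioo fun x' hx' hmem => ?_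
      have hx'r : x' ∈ Ioo (x - r) (x + r) := ⟨by linarith [hmem.1], by linarith [hmem.2]⟩
      exact hreal x' hx'r (ne_of_gt hmem.1) hx'
    · exact (lt_of_le_of_lt (lintegral_mono_set (Ioo_subset_Ioo (by linarith) (by linarith))) hmom).ne
  -- `M = (w - x) M₁`; `M₁ x = 0` by parity
  set M₁ : ℂ → ℂ := dslope M x with hM₁
  have hM₁d : DifferentiableOn ℂ M₁ (ball (x : ℂ) r) := (differentiableOn_dslope hball).2 hMd
  have hM₁eq : ∀ z, M z = (z - x) * M₁ z := by
    intro z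
    have h := sub_smul_dslope M (x : ℂ) z
    rw [smul_eq_mul, hMx, sub_zero] at h
    exact h.symm
  have hM₁x : M₁ x = 0 := by
    by_contra h0
    have hT : Tendsto (fun z : ℂ => (z - x) ^ 1 * Kt z) (𝓝[≠] (x : ℂ)) (𝓝 (M₁ x)) := by
      have hc : ContinuousAt M₁ x := hM₁d.continuousOn.continuousAt hball
      refine (hc.tendsto.mono_left nhdsWithin_le_nhds).congr' ?_
      filter_upwards [hpunct] with z hz
      have hzx : z - x ≠ 0 := sub_ne_zero.2 fun h => hz.2 h
      have h := hMeq hz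
      simp only [hM₁eq z] at h
      refine mul_left_cancel₀ hzx ?_
      rw [h]
      ring
    exact Nat.not_even_one (Analysis.even_order_of_nonneg_real_pole Kt x 1 (M₁ x) h0 hT hbdry).1
  -- `M₁ = (w - x) M₂`, and `K̃ = M₂` on the punctured disc
  set M₂ : ℂ → ℂ := dslope M₁ x with hM₂
  have hM₂d : DifferentiableOn ℂ M₂ (ball (x : ℂ) r) := (differentiableOn_dslope hball).2 hM₁d
  have hM₂eq : ∀ z, M₁ z = (z - x) * M₂ z := by
    intro z
    have h := sub_smul_dslope M₁ (x : ℂ) z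
    rw [smul_eq_mul, hM₁x, sub_zero] at h
    exact h.symm
  refine ⟨r, hr, M₂, hM₂d, fun z hz => ?_⟩
  have hzx : z - x ≠ 0 := sub_ne_zero.2 fun h => hz.2 h
  have h := hMeq hz
  simp only [hM₁eq z, hM₂eq z] at h
  refine mul_left_cancel₀ (pow_ne_zero 2 hzx) ?_
  rw [← h]
  ring

end RealLine

end Summit.CriticalPhenomena.SAWScalingLimit.Theorems.PolygonParitySqueeze

end
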